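import Summits.QuantumFields.YangMills.Theorems.BalabanUVNodesN15CurvedLaplacianSpecies
import HarnessLib

/-!
# Route «BalabanUVNodes» (cluster K4 «SpineRates»), Track-A DAG node N15 = NE2, BACKGROUND LAYER — GAUGE COVARIANCE OF THE TRANSPORTER-FORM OBJECTS: the covariant
# derivative, Bałaban's covariant Laplacian (3.50), the curved species (3.53) and its exact coefficients transform by CONJUGATION under a site-wise orthogonal gauge
# transformation; inverses transform with them; transporter letters and (3.42)-shaped block majorants are gauge-invariant up to `|ι|²`

Cell `pub-ymgap`, seat `pub-ymgap-dag-n15-w3` (WIDTH SEAT 3∕3 on node N15, director-ym №197 ∕ HUMAN RULING D-0149; plan g77 `W-SEAT-START-LIST.md` §n15 item 3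
«`NE2PlusOperator` for the background layer at GENERAL small-field U» — third piece).  `bears_on: R4∕N15 · K3⁷ SpineGivenEndpointR13SepCoPH (stmt-QuantumFields-20544)`.
Filed `--kind proof --supports stmt-QuantumFields-20544 --as helper` — COUNT-NEUTRAL.  Imports BY NAME this seat's file 1 `…N15CurvedLaplacianSpecies` (p583814: `gaugePair`,
`covSpeciesOpM`, `conjDef`, `curvCoefA`, `curvCoefC`, `covShiftDefect`, `vecAt`, `vecAt_covD`, `mmulOp_apply_mulVec`, `abs_entry_le_one_of_orthogonal`; through it dag-n15-c FILE 28
`covLapM`, n15-b parts 14∕18 `mmulOp`, `mmulOp_comp_mmulOp`, `hasMaj_mmulOp`, `covD`, FILE 1 `linearMap_sum_comp`∕`linearMap_comp_sum`, lit `B11SectG.hasMaj_comp`); nothing in the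
tree is modified.

WHY.  The regularity condition (3.35) of [Balaban1985BackgroundPropagators] p. 396 is a LOCAL GAUGE condition: *«for an arbitrary cube □ … there exists a gauge transformation u
on □ such that U^u = e^{iηA}, and … |A| < O(1)Mα₀(L^jη)^{−1}, |∇^ηA| < O(1)Mα₀(L^jη)^{−2} on □»* — a GENERAL small-field `U` is small only cube by cube, each cube in its
own gauge.  Every transporter-form letter of files 1–2 (`|S − 1| ≤ ηp`, `|S_μ − R₋ᵀS₋R₋| ≤ η²q`, the (3.42)-shaped block majorants of `G(U)` and of its covariant pieces) is
therefore only available AFTER a gauge transformation, and what makes the programme «NE2⁺ at a general small-field U» well posed is that every object involved transforms by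
CONJUGATION under a site-wise gauge transformation `w : X → O(ι)` (`U(x, y) ↦ w(x)U(x, y)w(y)⁻¹`, fields `f ↦ w·f`): THIS FILE types that covariance for the lineage's
transporter-form objects, exactly, and the resulting invariance of the letters (entrywise, up to the crude factor `|ι|²`) and of the block majorants (up to `|ι|²`).

* §1 the actions: `siteConj W A` (site-based matrices `A_j(x) ↦ W(x)A_j(x)W(x)ᵀ`), `trGaugeActFwd τ W R` (forward transporters `R_μ(x) ↦ W(x)R_μ(x)W(x + e_μ)ᵀ`),
  `trGaugeAct τ W Rp` (FILE 28's two-sided data); `gaugePair_trGaugeActFwd` (the gauge-field reading intertwines the two), `trGaugeActFwd_mul` (`(SR)^W = S^{W}R^W`);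
  `mmulOp_one`, `mmulOp_conj_comp_eq_id` (`M_{Wᵀ}M_W = id`);
* §2 ★ `covD_trGaugeAct`: `D_{R^W, s} = M_W ∘ D_{R, s} ∘ M_{Wᵀ}`; ★★ `covLapM_trGaugeAct`: `Δ_{Rp^W} = M_W ∘ Δ_{Rp} ∘ M_{Wᵀ}` (Bałaban's (3.50) is gauge covariant);
  `curvCoefA_trGaugeAct`, `curvCoefC_trGaugeAct`, `covShiftDefect_trGaugeAct` (file 1's exact coefficients and covariant backward difference CONJUGATE: `a^W = W a Wᵀ`, `c^W = W c Wᵀ`);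
  ★★ `covSpeciesOpM_trGaugeAct`: `V_{R^W}(c^W, a^W) = M_W ∘ V_R(c, a) ∘ M_{Wᵀ}`;
* §3 ★★ `conj_inverse_of_inverse` (`ΔG = id ⟹ (M_WΔM_{Wᵀ})(M_WGM_{Wᵀ}) = id`) and ★★★ `covLapM_trGaugeAct_inverse`: if `G` inverts `Δ_{gaugePair R} + P` then `M_WGM_{Wᵀ}` inverts
  `Δ_{gaugePair R^W} + M_WPM_{Wᵀ}` — THE PROPAGATOR AT THE GAUGE-TRANSFORMED BACKGROUND IS THE CONJUGATED PROPAGATOR (for a gauge-covariant remainder `P`);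
* §4 letters: `abs_conj_entry_le` (`|(WMWᵀ)_{ij}| ≤ |ι|²·max|M|` for `|W_{kl}| ≤ 1`), `transporterLetter_trGaugeAct` ∕ `covShiftLetter_trGaugeAct` (file 1's two letters survive a
  gauge change with the factor `|ι|²`), `rowSum_le_card_of_orthogonal`, ★★ `hasMaj_mmulOp_conj`: a block majorant `a·e^{−ρd}` of `T` gives `|ι|²a·e^{−ρd}` for `M_W ∘ T ∘ M_{W′}`
  (entrywise `|W|, |W′| ≤ 1`) — THE (3.42)-SHAPED LETTERS ARE GAUGE-INVARIANT UP TO `|ι|²`.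

HONEST FRAMING ∕ LIMITS.  Finite-lattice ALGEBRA + crude letters ([B9] (3.35)–(3.37) p. 396, (3.42) p. 397, (3.50)–(3.53) p. 400 = SHAPES ∕ MECHANISM; nothing of [B9] asserted).
What this does NOT do: patch the cube-wise gauges of (3.35) into ONE global estimate — that is [B6]'s random-walk ∕ gluing expansion (Prop. 2.6, `B6Prop26Gluing`), NOT touched; the
file only certifies that the objects and letters the lineage estimates are gauge-covariant, so that each may be computed in any gauge.  NE2⁺ NOT PRINTED, NOT proved; N15 NOT
discharged; counts of record UNMOVED (typed 28∕28 · discharged 5∕27); one finite 𝕋⁴ at fixed ε — NOT infinite volume, NOT OS on ℝ⁴, NOT a mass gap, NOT Clay; R4 closes the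
conditional finite-𝕋⁴ rung `BalabanLadder.UV` only.  Restate-immune (no Theses import).
-/

set_option autoImplicit false

noncomputable section
open scoped BigOperators Matrix
open Finset

namespace Summit.QuantumFields.YangMills.BalabanUVNodes.N15.CurvedSpecies

open Literature.MathematicalPhysics.QuantumFieldTheory.Balaban1983to89
open Literature.MathematicalPhysics.QuantumFieldTheory.Balaban1983to89.B11SectG (BlockNorm HasMaj hasMaj_comp)
open Literature.MathematicalPhysics.QuantumFieldTheory.Balaban1983to89.T4EtaRateCoeffDefect (diagK diagK_nonneg)
open Summit.QuantumFields.YangMills.BalabanUVNodes.N15.DerivDefect (sum_diagK_mul sum_mul_diagK)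
open Summit.QuantumFields.YangMills.BalabanUVNodes.N15.MatrixSpecies (mmulOp mmulOp_apply liftBlk covD covD_apply mmulOp_comp_mmulOp hasMaj_mmulOp)
open Summit.QuantumFields.YangMills.BalabanUVNodes.N15.BackgroundLayer (covLapM linearMap_sum_comp linearMap_comp_sum)
open Summit.QuantumFields.YangMills.BalabanUVNodes.N15.BackgroundModel (kappa_ofBlocks)

variable {X ι J : Type} [Fintype ι] [DecidableEq ι] [Fintype J]

/-! ## §1 The gauge actions on site matrices and on transporters; elementary algebra -/

section Actions

variable (τ : J → X ≃ X) (W : X → Matrix ι ι ℝ)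

/-- THE GAUGE ACTION ON SITE-BASED MATRIX FIELDS (any index type `κ`): `A_j(x) ↦ W(x)A_j(x)W(x)ᵀ` — how a perturbation transporter `S_μ(x) = R(U′_b)` based at `b₋ = x` and
every coefficient of the species transform. [cite: Balaban1985BackgroundPropagators, (3.35) p.396 (`U^u`: shape)] -/
def siteConj {κ : Type} (A : κ → X → Matrix ι ι ℝ) : κ → X → Matrix ι ι ℝ := fun j x => W x * A j x * (W x)ᵀ

/-- THE GAUGE ACTION ON FORWARD TRANSPORTERS: `R_μ(x) ↦ W(x)R_μ(x)W(x + e_μ)ᵀ` — `U(x, y) ↦ u(x)U(x, y)u(y)⁻¹` for an orthogonal `u`.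
[cite: Balaban1985BackgroundPropagators, (3.35) p.396 (`U^u`: shape)] -/
def trGaugeActFwd (R : J → X → Matrix ι ι ℝ) : J → X → Matrix ι ι ℝ := fun μ x => W x * R μ x * (W (τ μ x))ᵀ

/-- THE GAUGE ACTION ON FILE 28's TWO-SIDED TRANSPORT DATA: forward `Rp⁺_μ(x) ↦ W(x)Rp⁺_μ(x)W(x + e_μ)ᵀ`, backward `Rp⁻_μ(x) ↦ W(x)Rp⁻_μ(x)W(x − e_μ)ᵀ`.
[cite: Balaban1985BackgroundPropagators, (3.35) p.396 (`U^u`: shape)] -/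
def trGaugeAct (Rp : J ⊕ J → X → Matrix ι ι ℝ) : J ⊕ J → X → Matrix ι ι ℝ :=
  Sum.elim (fun μ x => W x * Rp (Sum.inl μ) x * (W (τ μ x))ᵀ) (fun μ x => W x * Rp (Sum.inr μ) x * (W ((τ μ).symm x))ᵀ)

omit [DecidableEq ι] [Fintype J] in
/-- Unfolding (forward). [folklore] -/
@[simp] theorem trGaugeAct_inl (Rp : J ⊕ J → X → Matrix ι ι ℝ) (μ : J) (x : X) :
    trGaugeAct τ W Rp (Sum.inl μ) x = W x * Rp (Sum.inl μ) x * (W (τ μ x))ᵀ := rfl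

omit [DecidableEq ι] [Fintype J] in
/-- Unfolding (backward). [folklore] -/
@[simp] theorem trGaugeAct_inr (Rp : J ⊕ J → X → Matrix ι ι ℝ) (μ : J) (x : X) :
    trGaugeAct τ W Rp (Sum.inr μ) x = W x * Rp (Sum.inr μ) x * (W ((τ μ).symm x))ᵀ := rfl

omit [DecidableEq ι] [Fintype J] in
/-- THE GAUGE-FIELD READING INTERTWINES THE ACTIONS: `gaugePair τ (R^W) = (gaugePair τ R)^W` (pure transpose algebra). [folklore] -/
theorem gaugePair_trGaugeActFwd (R : J → X → Matrix ι ι ℝ) : gaugePair τ (trGaugeActFwd τ W R) = trGaugeAct τ W (gaugePair τ R) := by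
  funext j x
  cases j with
  | inl μ => rfl
  | inr μ => simp only [gaugePair_inr, trGaugeActFwd, trGaugeAct_inr, Matrix.transpose_mul, Matrix.transpose_transpose, Matrix.mul_assoc, Equiv.apply_symm_apply]

omit [Fintype J] in
/-- `(SR)^W = S^W·R^W`: the gauge action on a perturbed transporter splits into the site conjugation of the perturbation and the action on the background (`WᵀW = 1`).
[folklore] -/
theorem trGaugeActFwd_mul (hW : ∀ x, (W x)ᵀ * W x = 1) (R S : J → X → Matrix ι ι ℝ) :
    trGaugeActFwd τ W (fun μ x => S μ x * R μ x) = fun μ x => siteConj W S μ x * trGaugeActFwd τ W R μ x := by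
  funext μ x
  simp only [trGaugeActFwd, siteConj, Matrix.mul_assoc]
  rw [← Matrix.mul_assoc (W x)ᵀ (W x), hW, Matrix.one_mul]

omit [Fintype J] in
/-- The trivial coefficient multiplies by the identity. [folklore] -/
theorem mmulOp_one : mmulOp (fun _ : X => (1 : Matrix ι ι ℝ)) = LinearMap.id := by
  refine LinearMap.ext fun f => funext fun p => ?_
  simp only [mmulOp_apply, LinearMap.id_apply, Matrix.one_apply, ite_mul, one_mul, zero_mul, Finset.sum_ite_eq, Finset.mem_univ, if_true]

omit [Fintype J] in
/-- `M_{Wᵀ} ∘ M_W = id` for `WᵀW = 1`. [folklore] -/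
theorem mmulOp_transpose_comp (hW : ∀ x, (W x)ᵀ * W x = 1) : mmulOp (fun x => (W x)ᵀ) ∘ₗ mmulOp W = LinearMap.id := by
  rw [mmulOp_comp_mmulOp, show (fun x => (W x)ᵀ * W x) = fun _ => (1 : Matrix ι ι ℝ) from funext hW, mmulOp_one]

omit [Fintype J] in
/-- `M_W ∘ M_{Wᵀ} = id` for `WWᵀ = 1`. [folklore] -/
theorem mmulOp_comp_transpose (hW : ∀ x, W x * (W x)ᵀ = 1) : mmulOp W ∘ₗ mmulOp (fun x => (W x)ᵀ) = LinearMap.id := by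
  rw [mmulOp_comp_mmulOp, show (fun x => W x * (W x)ᵀ) = fun _ => (1 : Matrix ι ι ℝ) from funext hW, mmulOp_one]

omit [Fintype J] in
/-- `M_{Wᵀ} ∘ (M_W ∘ Z) = Z` for `WᵀW = 1`. [folklore] -/
theorem mmulOp_transpose_comp_cancel (hW : ∀ x, (W x)ᵀ * W x = 1) {F : Type} [AddCommGroup F] [Module ℝ F] (Z : F →ₗ[ℝ] (X × ι → ℝ)) :
    mmulOp (fun x => (W x)ᵀ) ∘ₗ (mmulOp W ∘ₗ Z) = Z := by
  rw [← LinearMap.comp_assoc, mmulOp_transpose_comp W hW, LinearMap.id_comp]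

omit [DecidableEq ι] [Fintype J] in
/-- Conjugated coefficients multiply by the conjugated operator: `M_{WCW′} = M_W ∘ M_C ∘ M_{W′}`. [folklore] -/
theorem mmulOp_conj (C W' : X → Matrix ι ι ℝ) : mmulOp (fun x => W x * C x * W' x) = mmulOp W ∘ₗ mmulOp C ∘ₗ mmulOp W' := by
  rw [mmulOp_comp_mmulOp, mmulOp_comp_mmulOp]
  simp only [Matrix.mul_assoc]

end Actions

/-! ## §2 Covariance of the covariant derivative, of Bałaban's Laplacian, of the exact coefficients and of the curved species -/

section Covariance

variable (η : ℝ) (τ : J → X ≃ X) (W : X → Matrix ι ι ℝ)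

omit [Fintype ι] [DecidableEq ι] [Fintype J] in
/-- A field is determined by its fibre vectors. [folklore] -/
theorem eq_of_vecAt_eq {f₁ f₂ : X × ι → ℝ} (h : ∀ x, vecAt f₁ x = vecAt f₂ x) : f₁ = f₂ :=
  funext fun p => congrFun (h p.1) p.2

omit [DecidableEq ι] [Fintype J] in
/-- The matrix multiplication operator, fibrewise. [folklore] -/
theorem vecAt_mmulOp (C : X → Matrix ι ι ℝ) (f : X × ι → ℝ) (x : X) : vecAt (mmulOp C f) x = C x *ᵥ vecAt f x := rfl

omit [Fintype J] in
/-- ★ **THE COVARIANT DERIVATIVE IS GAUGE COVARIANT**: `D_{R^W, s} = M_W ∘ D_{R, s} ∘ M_{Wᵀ}` for `WWᵀ = 1` (`R^W(x) = W(x)R(x)W(sx)ᵀ`).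
[cite: Balaban1985BackgroundPropagators, (3.50) p.400 (shape)] -/
theorem covD_trGaugeAct (hW : ∀ x, W x * (W x)ᵀ = 1) (R : X → Matrix ι ι ℝ) (s : X → X) :
    covD η (fun x => W x * R x * (W (s x))ᵀ) s = mmulOp W ∘ₗ covD η R s ∘ₗ mmulOp (fun x => (W x)ᵀ) := by
  refine LinearMap.ext fun f => eq_of_vecAt_eq fun x => ?_
  rw [vecAt_covD, LinearMap.comp_apply, LinearMap.comp_apply, vecAt_mmulOp, vecAt_covD, vecAt_mmulOp, vecAt_mmulOp, Matrix.mulVec_smul, Matrix.mulVec_sub,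
    Matrix.mulVec_mulVec, Matrix.mulVec_mulVec, Matrix.mulVec_mulVec, hW, Matrix.one_mulVec]

/-- ★★ **BAŁABAN's COVARIANT LAPLACIAN (3.50) IS GAUGE COVARIANT**: `Δ_{Rp^W} = M_W ∘ Δ_{Rp} ∘ M_{Wᵀ}` for every two-sided transport datum `Rp` and `WWᵀ = 1`.
[cite: Balaban1985BackgroundPropagators, (3.50) p.400] -/
theorem covLapM_trGaugeAct (hW : ∀ x, W x * (W x)ᵀ = 1) (Rp : J ⊕ J → X → Matrix ι ι ℝ) :
    covLapM τ η (trGaugeAct τ W Rp) = mmulOp W ∘ₗ covLapM τ η Rp ∘ₗ mmulOp (fun x => (W x)ᵀ) := by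
  unfold covLapM
  have h : ∀ μ, covD η (trGaugeAct τ W Rp (Sum.inl μ)) (τ μ) + covD η (trGaugeAct τ W Rp (Sum.inr μ)) (τ μ).symm =
      mmulOp W ∘ₗ (covD η (Rp (Sum.inl μ)) (τ μ) + covD η (Rp (Sum.inr μ)) (τ μ).symm) ∘ₗ mmulOp (fun x => (W x)ᵀ) := fun μ => by
    rw [show trGaugeAct τ W Rp (Sum.inl μ) = fun x => W x * Rp (Sum.inl μ) x * (W (τ μ x))ᵀ from rfl,
      show trGaugeAct τ W Rp (Sum.inr μ) = fun x => W x * Rp (Sum.inr μ) x * (W ((τ μ).symm x))ᵀ from rfl,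
      covD_trGaugeAct η W hW (Rp (Sum.inl μ)) (τ μ), covD_trGaugeAct η W hW (Rp (Sum.inr μ)) (τ μ).symm, LinearMap.add_comp, LinearMap.comp_add]
  rw [Finset.sum_congr rfl fun μ _ => h μ, ← linearMap_comp_sum, ← linearMap_sum_comp]
  simp only [LinearMap.neg_comp, LinearMap.comp_neg, LinearMap.smul_comp, LinearMap.comp_smul]

variable (R S : J → X → Matrix ι ι ℝ)

omit [Fintype J] in
/-- Conjugation past a sandwiched `PᵀP = 1`. [folklore] -/
theorem transpose_mul_cancel_left {P M : Matrix ι ι ℝ} (h : Pᵀ * P = 1) : Pᵀ * (P * M) = M := by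
  rw [← Matrix.mul_assoc, h, Matrix.one_mul]

omit [Fintype J] in
/-- `1 − PMPᵀ = P(1 − M)Pᵀ` for `PPᵀ = 1`. [folklore] -/
theorem one_sub_conj {P M : Matrix ι ι ℝ} (h : P * Pᵀ = 1) : 1 - P * M * Pᵀ = P * (1 - M) * Pᵀ := by
  rw [Matrix.mul_sub, Matrix.sub_mul, Matrix.mul_one, h]

omit [Fintype J] in
/-- Right-nested form: `1 − P(MPᵀ) = P((1 − M)Pᵀ)` for `PPᵀ = 1`. [folklore] -/
theorem one_sub_conj' {P M : Matrix ι ι ℝ} (h : P * Pᵀ = 1) : 1 - P * (M * Pᵀ) = P * ((1 - M) * Pᵀ) := by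
  rw [Matrix.sub_mul, Matrix.one_mul, Matrix.mul_sub, h]

omit [Fintype J] in
/-- THE TRANSPORTED BACKWARD DEFECT CONJUGATES: `conjDef τ R^W S^W μ x = W(x)·conjDef τ R S μ x·W(x)ᵀ` (`WWᵀ = WᵀW = 1`). [folklore] -/
theorem conjDef_trGaugeAct (hW : ∀ x, W x * (W x)ᵀ = 1) (hW' : ∀ x, (W x)ᵀ * W x = 1) (μ : J) (x : X) :
    conjDef τ (trGaugeActFwd τ W R) (siteConj W S) μ x = W x * conjDef τ R S μ x * (W x)ᵀ := by
  simp only [conjDef, trGaugeActFwd, siteConj, Equiv.apply_symm_apply, Matrix.transpose_mul, Matrix.transpose_transpose, Matrix.mul_assoc]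
  rw [one_sub_conj' (hW ((τ μ).symm x))]
  simp only [Matrix.mul_assoc, transpose_mul_cancel_left (hW' ((τ μ).symm x))]

omit [Fintype J] in
/-- ★ **FILE 1's EXACT FIRST-ORDER COEFFICIENTS CONJUGATE**: `curvCoefA η τ R^W S^W = (curvCoefA η τ R S)^W`. [folklore] -/
theorem curvCoefA_trGaugeAct (hW : ∀ x, W x * (W x)ᵀ = 1) (hW' : ∀ x, (W x)ᵀ * W x = 1) :
    curvCoefA η τ (trGaugeActFwd τ W R) (siteConj W S) = siteConj W (curvCoefA η τ R S) := by
  funext j x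
  cases j with
  | inl μ =>
      simp only [siteConj, curvCoefA_inl, Matrix.mul_smul, Matrix.smul_mul]
      congr 1
      rw [Matrix.mul_sub, Matrix.sub_mul, Matrix.mul_one, hW]
  | inr μ =>
      rw [curvCoefA_inr, conjDef_trGaugeAct τ W R S hW hW' μ x]
      simp only [siteConj, curvCoefA_inr, Matrix.mul_smul, Matrix.smul_mul]

/-- ★ **FILE 1's EXACT ZEROTH-ORDER COEFFICIENT CONJUGATES**: `curvCoefC η τ R^W S^W = W·(curvCoefC η τ R S)·Wᵀ`. [folklore] -/
theorem curvCoefC_trGaugeAct (hW : ∀ x, W x * (W x)ᵀ = 1) (hW' : ∀ x, (W x)ᵀ * W x = 1) (x : X) :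
    curvCoefC η τ (trGaugeActFwd τ W R) (siteConj W S) x = W x * curvCoefC η τ R S x * (W x)ᵀ := by
  simp only [curvCoefC, curvCoefA_trGaugeAct η τ W R S hW hW', siteConj, Matrix.mul_smul, Matrix.smul_mul, Matrix.mul_sum, Matrix.sum_mul, Matrix.mul_sub,
    Matrix.sub_mul]

omit [Fintype J] in
/-- FILE 1's COVARIANT BACKWARD DIFFERENCE CONJUGATES: `covShiftDefect τ R^W S^W μ x = W(x)·covShiftDefect τ R S μ x·W(x)ᵀ`. [folklore] -/
theorem covShiftDefect_trGaugeAct (hW' : ∀ x, (W x)ᵀ * W x = 1) (μ : J) (x : X) :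
    covShiftDefect τ (trGaugeActFwd τ W R) (siteConj W S) μ x = W x * covShiftDefect τ R S μ x * (W x)ᵀ := by
  simp only [covShiftDefect, trGaugeActFwd, siteConj, Equiv.apply_symm_apply, Matrix.transpose_mul, Matrix.transpose_transpose, Matrix.mul_sub, Matrix.sub_mul]
  simp only [Matrix.mul_assoc, transpose_mul_cancel_left (hW' ((τ μ).symm x))]

/-- ★★ **THE CURVED SPECIES IS GAUGE COVARIANT**: `V_{Rp^W}(WCWᵀ, A^W) = M_W ∘ V_{Rp}(C, A) ∘ M_{Wᵀ}` (`WWᵀ = WᵀW = 1`); with file 1's (3.53)-curved and `covLapM_trGaugeAct`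
both sides of `Δ_{SR} = Δ_R − V_R(c, a)` transform alike. [cite: Balaban1985BackgroundPropagators, (3.52)–(3.53) p.400 (shape)] -/
theorem covSpeciesOpM_trGaugeAct (hW : ∀ x, W x * (W x)ᵀ = 1) (hW' : ∀ x, (W x)ᵀ * W x = 1) (Rp : J ⊕ J → X → Matrix ι ι ℝ) (C : X → Matrix ι ι ℝ)
    (A : J ⊕ J → X → Matrix ι ι ℝ) :
    covSpeciesOpM η τ (trGaugeAct τ W Rp) (fun x => W x * C x * (W x)ᵀ) (siteConj W A) =
      mmulOp W ∘ₗ covSpeciesOpM η τ Rp C A ∘ₗ mmulOp (fun x => (W x)ᵀ) := by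
  unfold covSpeciesOpM
  have hmid : ∀ (B : X → Matrix ι ι ℝ) (T : (X × ι → ℝ) →ₗ[ℝ] (X × ι → ℝ)),
      mmulOp (fun x => W x * B x * (W x)ᵀ) ∘ₗ (mmulOp W ∘ₗ T ∘ₗ mmulOp (fun x => (W x)ᵀ)) = mmulOp W ∘ₗ (mmulOp B ∘ₗ T) ∘ₗ mmulOp (fun x => (W x)ᵀ) := by
    intro B T
    rw [mmulOp_conj]
    simp only [LinearMap.comp_assoc, mmulOp_transpose_comp_cancel W hW']
  have h : ∀ μ, mmulOp (siteConj W A (Sum.inl μ)) ∘ₗ covD η (trGaugeAct τ W Rp (Sum.inl μ)) (τ μ) -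
      mmulOp (siteConj W A (Sum.inr μ)) ∘ₗ covD η (trGaugeAct τ W Rp (Sum.inr μ)) (τ μ).symm =
      mmulOp W ∘ₗ (mmulOp (A (Sum.inl μ)) ∘ₗ covD η (Rp (Sum.inl μ)) (τ μ) - mmulOp (A (Sum.inr μ)) ∘ₗ covD η (Rp (Sum.inr μ)) (τ μ).symm) ∘ₗ
        mmulOp (fun x => (W x)ᵀ) := fun μ => by
    rw [show trGaugeAct τ W Rp (Sum.inl μ) = fun x => W x * Rp (Sum.inl μ) x * (W (τ μ x))ᵀ from rfl,
      show trGaugeAct τ W Rp (Sum.inr μ) = fun x => W x * Rp (Sum.inr μ) x * (W ((τ μ).symm x))ᵀ from rfl,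
      show siteConj W A (Sum.inl μ) = fun x => W x * A (Sum.inl μ) x * (W x)ᵀ from rfl, show siteConj W A (Sum.inr μ) = fun x => W x * A (Sum.inr μ) x * (W x)ᵀ from rfl,
      covD_trGaugeAct η W hW, covD_trGaugeAct η W hW, hmid, hmid, LinearMap.sub_comp, LinearMap.comp_sub]
  rw [Finset.sum_congr rfl fun μ _ => h μ, ← linearMap_comp_sum, ← linearMap_sum_comp, mmulOp_conj]
  simp only [LinearMap.comp_add, LinearMap.add_comp]

end Covariance

/-! ## §3 Inverses transform with the operators -/

section Inverses

variable (η : ℝ) (τ : J → X ≃ X) (W : X → Matrix ι ι ℝ)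

omit [Fintype J] in
/-- ★★ **CONJUGATED INVERSES**: `Δ ∘ G = id ⟹ (M_WΔM_{Wᵀ}) ∘ (M_WGM_{Wᵀ}) = id` (`WWᵀ = WᵀW = 1`). [folklore] -/
theorem conj_inverse_of_inverse (hW : ∀ x, W x * (W x)ᵀ = 1) (hW' : ∀ x, (W x)ᵀ * W x = 1) {Δ G : (X × ι → ℝ) →ₗ[ℝ] (X × ι → ℝ)}
    (h : Δ ∘ₗ G = LinearMap.id) :
    (mmulOp W ∘ₗ Δ ∘ₗ mmulOp (fun x => (W x)ᵀ)) ∘ₗ (mmulOp W ∘ₗ G ∘ₗ mmulOp (fun x => (W x)ᵀ)) = LinearMap.id := by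
  simp only [LinearMap.comp_assoc, mmulOp_transpose_comp_cancel W hW']
  rw [← LinearMap.comp_assoc (mmulOp fun x => (W x)ᵀ) G Δ, h, LinearMap.id_comp, mmulOp_comp_transpose W hW]

variable (R : J → X → Matrix ι ι ℝ)

/-- ★★★ **THE PROPAGATOR AT THE GAUGE-TRANSFORMED BACKGROUND IS THE CONJUGATED PROPAGATOR.**  If `G` is a left inverse of `covLapM τ η (gaugePair τ R) + P` (the operator at
the background `R` with a remainder `P`), then `M_WGM_{Wᵀ}` is a left inverse of `covLapM τ η (gaugePair τ R^W) + M_WPM_{Wᵀ}` — for a gauge-covariant remainder this is the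
operator at the transformed background; hence every letter of `G(U)` may be computed in any gauge, e.g. cube by cube in the local gauge of (3.35).
[cite: Balaban1985BackgroundPropagators, (3.35) p.396, (3.50) p.400 (shapes)] -/
theorem covLapM_trGaugeAct_inverse (hW : ∀ x, W x * (W x)ᵀ = 1) (hW' : ∀ x, (W x)ᵀ * W x = 1) {P G : (X × ι → ℝ) →ₗ[ℝ] (X × ι → ℝ)}
    (hG : (covLapM τ η (gaugePair τ R) + P) ∘ₗ G = LinearMap.id) :
    (covLapM τ η (gaugePair τ (trGaugeActFwd τ W R)) + mmulOp W ∘ₗ P ∘ₗ mmulOp (fun x => (W x)ᵀ)) ∘ₗ (mmulOp W ∘ₗ G ∘ₗ mmulOp (fun x => (W x)ᵀ)) =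
      LinearMap.id := by
  have h := conj_inverse_of_inverse W hW hW' hG
  rw [LinearMap.add_comp, LinearMap.comp_add] at h
  rw [gaugePair_trGaugeActFwd, covLapM_trGaugeAct η τ W hW]
  exact h

end Inverses

/-! ## §4 The letters under a gauge change: entrywise transporter letters and block majorants are invariant up to `|ι|²` -/

section Letters

variable (τ : J → X ≃ X) (W : X → Matrix ι ι ℝ) (R S : J → X → Matrix ι ι ℝ)

omit [DecidableEq ι] [Fintype J] in
/-- ENTRY LETTER OF A TRIPLE PRODUCT: `|(ABC)_{ij}| ≤ |ι|²·a·b·c` from entrywise bounds `|A| ≤ a`, `|B| ≤ b`, `|C| ≤ c`. [folklore] -/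
theorem abs_mul_mul_entry_le {A B C : Matrix ι ι ℝ} {a b c : ℝ} (hA : ∀ i j, |A i j| ≤ a) (hB : ∀ i j, |B i j| ≤ b) (hC : ∀ i j, |C i j| ≤ c) (i j : ι) :
    |(A * B * C) i j| ≤ (Fintype.card ι : ℝ) ^ 2 * (a * b * c) := by
  have ha : 0 ≤ a := (abs_nonneg _).trans (hA i i)
  have hb : 0 ≤ b := (abs_nonneg _).trans (hB i i)
  have hent : ∀ k l, |A i k * B k l * C l j| ≤ a * b * c := fun k l => by
    rw [abs_mul, abs_mul]
    have h1 := hA i k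
    have h2 := hB k l
    have h3 := hC l j
    exact mul_le_mul (mul_le_mul h1 h2 (abs_nonneg _) ha) h3 (abs_nonneg _) (mul_nonneg ha hb)
  rw [Matrix.mul_apply]
  calc |∑ l, (A * B) i l * C l j| ≤ ∑ l, |(A * B) i l * C l j| := Finset.abs_sum_le_sum_abs _ _
    _ ≤ ∑ l, ∑ k, |A i k * B k l * C l j| := Finset.sum_le_sum fun l _ => by
        rw [Matrix.mul_apply, Finset.sum_mul]; exact Finset.abs_sum_le_sum_abs _ _
    _ ≤ ∑ _l : ι, ∑ _k : ι, a * b * c := Finset.sum_le_sum fun l _ => Finset.sum_le_sum fun k _ => hent k l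
    _ = (Fintype.card ι : ℝ) ^ 2 * (a * b * c) := by rw [Finset.sum_const, Finset.sum_const, Finset.card_univ, nsmul_eq_mul, nsmul_eq_mul]; ring

omit [DecidableEq ι] [Fintype J] in
/-- ENTRY LETTER OF A CONJUGATE: `|(PMQ)_{ij}| ≤ |ι|²·m` from `|M_{kl}| ≤ m` and `|P_{kl}|, |Q_{kl}| ≤ 1`. [folklore] -/
theorem abs_conj_entry_le {P M Q : Matrix ι ι ℝ} {m : ℝ} (hP : ∀ i j, |P i j| ≤ 1) (hQ : ∀ i j, |Q i j| ≤ 1) (hM : ∀ i j, |M i j| ≤ m) (i j : ι) :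
    |(P * M * Q) i j| ≤ (Fintype.card ι : ℝ) ^ 2 * m := by
  have h := abs_mul_mul_entry_le hP hM hQ i j
  rwa [one_mul, mul_one] at h

omit [Fintype J] in
/-- FILE 1's FIELD LETTER SURVIVES A GAUGE CHANGE with the factor `|ι|²`: `|S^W − 1| ≤ |ι|²·ηp` from `|S − 1| ≤ ηp` (entrywise; `WWᵀ = 1`). [cite: Balaban1985BackgroundPropagators, (3.35)–(3.37) p.396 (shapes)] -/
theorem transporterLetter_trGaugeAct {η p : ℝ} (hW : ∀ x, W x * (W x)ᵀ = 1) (hSp : ∀ μ x i j, |(S μ x - 1) i j| ≤ η * p) (μ : J) (x : X) (i j : ι) :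
    |(siteConj W S μ x - 1) i j| ≤ (Fintype.card ι : ℝ) ^ 2 * (η * p) := by
  have hW1 : ∀ y k l, |W y k l| ≤ 1 := fun y k l => abs_entry_le_one_of_orthogonal (hW y) k l
  have hWt : ∀ k l, |(W x)ᵀ k l| ≤ 1 := fun k l => by rw [Matrix.transpose_apply]; exact hW1 x l k
  have h : siteConj W S μ x - 1 = W x * (S μ x - 1) * (W x)ᵀ := by
    rw [siteConj, Matrix.mul_sub, Matrix.sub_mul, Matrix.mul_one, hW]
  rw [h]
  exact abs_conj_entry_le (hW1 x) hWt (hSp μ x) i j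

omit [Fintype J] in
/-- FILE 1's COVARIANT-GRADIENT LETTER SURVIVES A GAUGE CHANGE with the factor `|ι|²`. [cite: Balaban1985BackgroundPropagators, (3.35)–(3.37) p.396 (shapes)] -/
theorem covShiftLetter_trGaugeAct {η q : ℝ} (hW : ∀ x, W x * (W x)ᵀ = 1) (hW' : ∀ x, (W x)ᵀ * W x = 1)
    (hSq : ∀ μ x i j, |covShiftDefect τ R S μ x i j| ≤ η ^ 2 * q) (μ : J) (x : X) (i j : ι) :
    |covShiftDefect τ (trGaugeActFwd τ W R) (siteConj W S) μ x i j| ≤ (Fintype.card ι : ℝ) ^ 2 * (η ^ 2 * q) := by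
  have hW1 : ∀ y k l, |W y k l| ≤ 1 := fun y k l => abs_entry_le_one_of_orthogonal (hW y) k l
  have hWt : ∀ k l, |(W x)ᵀ k l| ≤ 1 := fun k l => by rw [Matrix.transpose_apply]; exact hW1 x l k
  rw [covShiftDefect_trGaugeAct τ W R S hW' μ x]
  exact abs_conj_entry_le (hW1 x) hWt (hSq μ x) i j

omit [DecidableEq ι] [Fintype J] in
/-- Rows of an entrywise-bounded gauge transformation: `Σ_j|W(x)_{ij}| ≤ |ι|`. [folklore] -/
theorem rowSum_le_card_of_entry_le_one {W₀ : X → Matrix ι ι ℝ} (hW1 : ∀ x i j, |W₀ x i j| ≤ 1) (x : X) (i : ι) :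
    ∑ j, |W₀ x i j| ≤ (Fintype.card ι : ℝ) := by
  calc ∑ j, |W₀ x i j| ≤ ∑ _j : ι, (1 : ℝ) := Finset.sum_le_sum fun j _ => hW1 x i j
    _ = (Fintype.card ι : ℝ) := by rw [Finset.sum_const, Finset.card_univ, nsmul_eq_mul, mul_one]

variable {g : B6.Geometry} (blk : X → g.Site) [Fintype X]

omit [DecidableEq ι] [Fintype J] in
/-- ★★ **(3.42)-SHAPED BLOCK MAJORANTS ARE GAUGE-INVARIANT UP TO `|ι|²`.**  If `T` (a propagator, a covariant piece, a dressed object on the product carrier blocked by `blk`) has the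
block majorant `a·e^{−ρd}`, then its conjugate `M_W ∘ T ∘ M_{W′}` by entrywise-bounded site matrices (`|W|, |W′| ≤ 1` — every orthogonal gauge transformation) has the block
majorant `|ι|²·a·e^{−ρd}`: the letters of `G(U^u) = M_uG(U)M_{u⁻¹}` are those of `G(U)` up to `|ι|²`, so they may be verified in ANY gauge.
[cite: Balaban1985BackgroundPropagators, (3.35) p.396, (3.42) p.397 (shapes)] -/
theorem hasMaj_mmulOp_conj {W₀ W' : X → Matrix ι ι ℝ} {T : (X × ι → ℝ) →ₗ[ℝ] (X × ι → ℝ)} {a ρ : ℝ} (ha : 0 ≤ a) (hW1 : ∀ x i j, |W₀ x i j| ≤ 1)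
    (hW1' : ∀ x i j, |W' x i j| ≤ 1) (hT : HasMaj (BlockNorm.ofBlocks g (liftBlk blk ι)) (BlockNorm.ofBlocks g (liftBlk blk ι)) T (fun y y' => a * Real.exp (-(ρ * g.dist y y')))) :
    HasMaj (BlockNorm.ofBlocks g (liftBlk blk ι)) (BlockNorm.ofBlocks g (liftBlk blk ι)) (mmulOp W₀ ∘ₗ T ∘ₗ mmulOp W')
      (fun y y' => (Fintype.card ι : ℝ) ^ 2 * a * Real.exp (-(ρ * g.dist y y'))) := by
  have hι : 0 ≤ (Fintype.card ι : ℝ) := Nat.cast_nonneg _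
  have hMW : HasMaj (BlockNorm.ofBlocks g (liftBlk blk ι)) (BlockNorm.ofBlocks g (liftBlk blk ι)) (mmulOp W₀) (diagK fun _ => (Fintype.card ι : ℝ)) :=
    hasMaj_mmulOp blk (fun _ => hι) (fun x i => rowSum_le_card_of_entry_le_one hW1 x i)
  have hMW' : HasMaj (BlockNorm.ofBlocks g (liftBlk blk ι)) (BlockNorm.ofBlocks g (liftBlk blk ι)) (mmulOp W') (diagK fun _ => (Fintype.card ι : ℝ)) :=
    hasMaj_mmulOp blk (fun _ => hι) (fun x i => rowSum_le_card_of_entry_le_one hW1' x i)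
  have h1 : HasMaj (BlockNorm.ofBlocks g (liftBlk blk ι)) (BlockNorm.ofBlocks g (liftBlk blk ι)) (T ∘ₗ mmulOp W')
      (fun y y' => a * (Fintype.card ι : ℝ) * Real.exp (-(ρ * g.dist y y'))) := by
    refine (hasMaj_comp hT hMW' fun _ _ => mul_nonneg ha (Real.exp_nonneg _)).mono fun y y' => le_of_eq ?_
    rw [kappa_ofBlocks]
    simp only [one_mul]
    rw [sum_mul_diagK]
    ring
  refine (hasMaj_comp hMW h1 fun _ _ => diagK_nonneg (fun _ => hι) _ _).mono fun y y' => le_of_eq ?_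
  rw [kappa_ofBlocks]
  simp only [one_mul]
  rw [sum_diagK_mul]
  ring

end Letters

end Summit.QuantumFields.YangMills.BalabanUVNodes.N15.CurvedSpecies

end
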